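import Summits.RiemannHypothesis.RiemannHypothesis.Theorems.GroundBartaEvenWinsBeyondArchDeflationM80PEvenLowerGW
import Summits.RiemannHypothesis.RiemannHypothesis.Theorems.GroundBartaEvenWinsBeyondArchDeflationM80FOddLowerGW
import Summits.RiemannHypothesis.RiemannHypothesis.Theorems.GroundBartaEvenWinsBeyondArchDeflationConsequences
import Literature.NumberTheory.LFunctions.WeilGroundEnergyParitySplit
import HarnessLib

/-!
# RiemannHypothesis / GroundBarta — rung 4: RH-free WEIL POSITIVITY ON THE WINDOW `[-4023/5000, 4023/5000]`

Helper file (`--supports stmt-RiemannHypothesis-18085`), RH-free.  Prover A (g9), speedrun unit `sr-gb-rung-a`; the R-layer certificate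
`RM80Q` was produced with prover B's generator (unit `sr-gb-rung-b`).

**`weilPositivityOn_8046 : WeilPositivityOn (4023/5000)`** — Weil's quadratic form satisfies `Re W(g ⋆ g̃) ≥ 0` for every smooth
test function `g` with `tsupport g ⊆ [-0.8046, 0.8046]`, i.e. multiplicatively for test functions on `(e^{-0.8046}, e^{0.8046})`,
`e^{1.6092} = 4.9988…`: the prime powers `2, 3, 4` are visible ((log 5)/2 = 0.80472 is the end of the three-prime window).
Unconditional (no RH, no conjecture input; axioms `propext`, `Classical.choice`, `Quot.sound`); equivalently
`weilGroundEnergy_8046_nonneg : 0 ≤ ε(4023/5000)` (`ε = min(ε_ev, ε_od)`).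

It is the conjunction of the two sector blocks of the deflated Temple (Lehmann–Goerisch) L-side at `c = 4023/5000`:

* odd sector: `m80F_oddLower_litW : 21/10¹⁷ ≤ ε_od(4023/5000)` (cell 5 of the parity ladder; provers A g5/g7 + B g4);
* even sector: `m80P_evenLower_litW : 0 ≤ ε_ev(4023/5000)` (the positivity-grade EVEN block: even-sector β-certificate
  `WeilTwoPrimeDeflM80PCert` at `N = 271`, A-layer of six even Ritz vectors, R-layer `RM80Q`, weighted cross-Gram kernel certificate);

glued by `dt_weilPositivityOn` (`Re W(g ⋆ g̃) ≥ ε_ev‖g_ev‖² + ε_od‖g_od‖²`).  By monotonicity (`WeilPositivityOn.mono`) every window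
`a ≤ 4023/5000` is a positivity window; the windows `18/25` and `log 2` (rhdoor LADDER R4a/R4b, with STRICT `0 < ε(18/25)`) are
prover B's `weilPositivityOn_M72` / `weilPositivityOn_log_two` (`Theorems/WeilPositivityLogTwo.lean`).  (The even block here is
`λ = 0`-grade: the R-layer weights `wI = 1/(17/25 − λ)`, `wE = 1/(17/25 − κ₂ − λ)` were fixed at `λ = 0`, so strictness of `ε_ev` at
`4023/5000` is not claimed.)
Context: unconditional positive definiteness was known for `a ≤ (log 2)/2 = 0.3466` (no prime visible) [Yoshida 1992]; the tree's
previous certified windows were `59/100` (`weilPositivityOn_59_100`) and `(log 3)/2`.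
-/

set_option linter.dupNamespace false

noncomputable section

namespace Summit.RiemannHypothesis.RiemannHypothesis.Theorems.EvenWinsBeyondArch

open Literature.NumberTheory.LFunctions

/-- **The even block**: `0 ≤ ε_ev(4023/5000)`. [folklore] -/
theorem weilEvenGroundEnergy_8046_nonneg : 0 ≤ weilEvenGroundEnergy (4023 / 5000 : ℝ) :=
  m80P_evenLower_litW

/-- **The odd block**: `0 < ε_od(4023/5000)` (`≥ 2.1·10⁻¹⁶`). [folklore] -/
theorem weilOddGroundEnergy_8046_pos : 0 < weilOddGroundEnergy (4023 / 5000 : ℝ) :=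
  lt_of_lt_of_le (lt_trans (by norm_num) m80F_oddLower_litW.1) m80F_oddLower_litW.2

/-- **RH-free Weil positivity on the window `[-4023/5000, 4023/5000]`** (three visible prime powers `2, 3, 4`). [folklore] -/
theorem weilPositivityOn_8046 : WeilPositivityOn (4023 / 5000 : ℝ) :=
  dt_weilPositivityOn weilEvenGroundEnergy_8046_nonneg weilOddGroundEnergy_8046_pos.le

/-- Weil positivity on every window `a ≤ 4023/5000`. [folklore] -/
theorem weilPositivityOn_of_le_8046 {a : ℝ} (ha : a ≤ 4023 / 5000) : WeilPositivityOn a :=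
  weilPositivityOn_8046.mono ha

/-- The bottom of Weil's form on the window `[-4023/5000, 4023/5000]` is non-negative:
`ε(4023/5000) = min(ε_ev, ε_od)(4023/5000) ≥ 0`. [folklore] -/
theorem weilGroundEnergy_8046_nonneg : 0 ≤ weilGroundEnergy (4023 / 5000 : ℝ) := by
  rw [weilGroundEnergy_eq_min_even_odd]
  exact le_min weilEvenGroundEnergy_8046_nonneg weilOddGroundEnergy_8046_pos.le

end Summit.RiemannHypothesis.RiemannHypothesis.Theorems.EvenWinsBeyondArch

end
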